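import Mathlib
import Summits.MatrixMultiplication.MatrixMultiplication.Theses.LevelGradedCohnUmans
import Literature.Analysis.Fourier.FiniteUncertaintyPrinciple

/-!
# Frobenius cells — sketch of the typed statements (crux-strategist s1, crux `GradedDesignFamily`)

Host: the affine Frobenius group `Aff p H = ZMod p ⋊ H` (`H ≤ (ZMod p)ˣ`, `p` prime), element
`⟨b, t⟩ ↔ (x ↦ t x + b)`.  Test space: `frobeniusSpace Sg` = functions whose Fourier transform along
every slope fibre is supported in `Sg ⊆ ZMod p` (`0 ∉ Sg`, `Sg` stable under `H`).  Claims (stubs):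
bi-invariance; the EXACT separation criterion (TPP + thin target slices ⇒ separated, by Tao 2005 /
Chebotarev, in tree); the budget `∑_{Irr ∩ J} χ(1)^s ≤ |Sg|·|H|^{s-1}`; and the open design stub.
-/

set_option linter.dupNamespace false

namespace Summit.MatrixMultiplication.MatrixMultiplication.Cruxes.GradedDesignFamily.FrobeniusCells

open scoped BigOperators
open Literature.Combinatorics.Additive Literature.RepresentationTheory.FiniteGroups
open Summit.MatrixMultiplication.MatrixMultiplication.Theses.LevelGradedCohnUmans

noncomputable section

variable (p : ℕ) [Fact p.Prime] (H : Subgroup (ZMod p)ˣ)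

/-- The slope group `H ≤ (ZMod p)ˣ` acting on the translations `ZMod p` by multiplication. -/
def slopeAction : H →* MulAut (Multiplicative (ZMod p)) :=
  (MulAutMultiplicative (ZMod p)).symm.toMonoidHom.comp (AddAut.mulLeft.comp H.subtype)

/-- The affine Frobenius group `Aff p H = {x ↦ t x + b : t ∈ H, b ∈ ZMod p}` as a semidirect
product; `⟨b, t⟩ * ⟨b', t'⟩ = ⟨b + t b', t t'⟩`. -/
abbrev Aff : Type := Multiplicative (ZMod p) ⋊[slopeAction p H] H

instance : Finite (Aff p H) := Finite.of_equiv _ SemidirectProduct.equivProd.symm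

noncomputable instance : Fintype (Aff p H) := Fintype.ofFinite _

/-- Evaluation of the fibrewise Fourier coefficient at slope `t` and frequency `a`:
`f ↦ ∑_b f⟨b,t⟩ ψ(-a b)`. -/
def fourierCoeff (t : H) (a : ZMod p) : (Aff p H → ℂ) →ₗ[ℂ] ℂ :=
  ∑ b : ZMod p, ((ZMod.stdAddChar (-(a * b)) : ℂ)) •
    LinearMap.proj (R := ℂ) (φ := fun _ : Aff p H => ℂ) (⟨Multiplicative.ofAdd b, t⟩ : Aff p H)

/-- The Frobenius test space `J_Sg`: functions on `Aff p H` whose Fourier transform along every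
slope fibre vanishes outside `Sg`. -/
def frobeniusSpace (Sg : Finset (ZMod p)) : Submodule ℂ (Aff p H → ℂ) :=
  ⨅ t : H, ⨅ a ∈ (Sgᶜ : Finset (ZMod p)), LinearMap.ker (fourierCoeff p H t a)

variable {p H}

/-- Bi-invariance of a test space (the crux's clause). -/
def BiInv {G : Type} [Group G] (J : Submodule ℂ (G → ℂ)) : Prop :=
  ∀ f ∈ J, ∀ a b : G, (fun g : G => f (a * g * b)) ∈ J

/-- `J`-separation of `(X, Y, Z)` (the crux's clause, verbatim shape). -/
def Separated {G : Type} [Group G] (J : Submodule ℂ (G → ℂ)) (X Y Z : Finset G) : Prop :=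
  ∀ x₀ ∈ X, ∀ z₀ ∈ Z, ∃ f ∈ J, ∀ x ∈ X, ∀ y ∈ Y, ∀ y' ∈ Y, ∀ z ∈ Z,
    (x = x₀ ∧ y = y' ∧ z = z₀ → f (x⁻¹ * y * y'⁻¹ * z) = 1) ∧
    (¬ (x = x₀ ∧ y = y' ∧ z = z₀) → f (x⁻¹ * y * y'⁻¹ * z) = 0)

/-- The quadruple-product set `P = X⁻¹ Y Y⁻¹ Z`. -/
def quadSet {G : Type} [Group G] [DecidableEq G] (X Y Z : Finset G) : Finset G :=
  (X ×ˢ Y ×ˢ Y ×ˢ Z).image fun q => q.1⁻¹ * q.2.1 * q.2.2.1⁻¹ * q.2.2.2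

/-- THIN TARGET SLICES: for every target `x₀⁻¹ z₀`, the elements of `P` with the SAME SLOPE as the
target number at most `σ`. -/
def ThinSlices (σ : ℕ) (X Y Z : Finset (Aff p H)) : Prop :=
  ∀ x₀ ∈ X, ∀ z₀ ∈ Z,
    ((quadSet X Y Z).filter fun g => g.right = (x₀⁻¹ * z₀).right).card ≤ σ

/-- Admissible frequency sets: `0 ∉ Sg` and `Sg` is a union of `H`-orbits. -/
def Admissible (Sg : Finset (ZMod p)) : Prop :=
  (0 : ZMod p) ∉ Sg ∧ ∀ t : H, ∀ a ∈ Sg, ((t : (ZMod p)ˣ) : ZMod p) * a ∈ Sg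

variable (p H)

/-- STUB (S, provable now): `J_Sg` is bi-invariant for admissible `Sg` (left translation scales
the fibre spectrum by the slope, right translation only shifts phases). -/
def FrobeniusBiInv : Prop :=
  ∀ Sg : Finset (ZMod p), Admissible (p := p) (H := H) Sg → BiInv (frobeniusSpace p H Sg)

/-- STUB (M, provable now from `tao2005_uncertainty_prime`, in tree): the EXACT CRITERION,
sufficient direction — TPP + thin target slices (`≤ |Sg|`) ⇒ `J_Sg`-separated. -/
def FrobeniusCriterion : Prop :=
  ∀ Sg : Finset (ZMod p), Admissible (p := p) (H := H) Sg →
    ∀ X Y Z : Finset (Aff p H), TripleProductProperty X Y Z → ThinSlices Sg.card X Y Z →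
      Separated (frobeniusSpace p H Sg) X Y Z

/-- STUB (M, provable now): graded budget of the Frobenius cell — the irreducible characters
inside `J_Sg` are `|Sg|/|H|` induced characters of degree `|H|`, so
`∑_{Irr ∩ J_Sg} χ(1)^s ≤ |Sg|·|H|^{s-1}` (route: block containment `∑ χ(1)² ≤ dim J_Sg ≤ |Sg||H|`,
landed as `stub_blockContainment`, plus the degree bound `χ(1) ≤ |H|`). -/
def FrobeniusBudget : Prop :=
  ∀ Sg : Finset (ZMod p), Admissible (p := p) (H := H) Sg → ∀ s : ℝ, 2 ≤ s →
    (∑ᶠ χ ∈ irrChars (Aff p H) ∩ (frobeniusSpace p H Sg : Set (Aff p H → ℂ)), (χ 1).re ^ s)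
      ≤ (Sg.card : ℝ) * (Nat.card H : ℝ) ^ (s - 1)

/-- STUB (XL, OPEN — the design stub): Frobenius-cell designs for every `ε`: TPP triples in some
`Aff p H` with thin target slices and volume beating the cell budget `|Sg|·|H|^{1+ε}`. -/
def FrobeniusDesigns : Prop :=
  ∀ ε : ℝ, 0 < ε → ∃ (p : ℕ) (_ : Fact p.Prime) (H : Subgroup (ZMod p)ˣ) (Sg : Finset (ZMod p))
    (X Y Z : Finset (Aff p H)), Admissible (p := p) (H := H) Sg ∧ TripleProductProperty X Y Z ∧
      ThinSlices Sg.card X Y Z ∧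
      (Sg.card : ℝ) * (Nat.card H : ℝ) ^ (1 + ε) < ((X.card * Y.card * Z.card : ℕ) : ℝ) ^ ((2 + ε) / 3)

/-- COMPOSITION (kernel-checkable glue): the three provable stubs and the design stub give the
crux BY NAME. -/
theorem GradedDesignFamily_of
    (hB : ∀ (p : ℕ) [Fact p.Prime] (H : Subgroup (ZMod p)ˣ), FrobeniusBiInv p H)
    (hC : ∀ (p : ℕ) [Fact p.Prime] (H : Subgroup (ZMod p)ˣ), FrobeniusCriterion p H)
    (hBu : ∀ (p : ℕ) [Fact p.Prime] (H : Subgroup (ZMod p)ˣ), FrobeniusBudget p H)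
    (hD : FrobeniusDesigns) : GradedDesignFamily := by
  intro ε hε
  obtain ⟨p, hp, H, Sg, X, Y, Z, hadm, htpp, hthin, hlt⟩ := hD ε hε
  refine ⟨Aff p H, inferInstance, inferInstance, frobeniusSpace p H Sg, X, Y, Z, ?_, ?_, ?_⟩
  · exact hB p H Sg hadm
  · exact hC p H Sg hadm X Y Z htpp hthin
  · have h2 : (2 : ℝ) ≤ 2 + ε := by linarith
    have hbud := hBu p H Sg hadm (2 + ε) h2
    have hs : (2 + ε - 1 : ℝ) = 1 + ε := by ring
    rw [hs] at hbud
    exact lt_of_le_of_lt hbud hlt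

end

end Summit.MatrixMultiplication.MatrixMultiplication.Cruxes.GradedDesignFamily.FrobeniusCells
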